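import Literature.Computability.AlgebraicComplexity.Bur24GCTOpenProblems
import Literature.Computability.AlgebraicComplexity.BI17NonNormalOrbitClosuresProofs
import HarnessLib

/-!
# Kumar 2013, Thms. 3.8 and 4.5 — discharge of `Kumar2013_thm_3_8` and `Kumar2013_thm_4_5`
# (the orbit closures of `det_m` and `per_n` are not normal, `m, n ≥ 3`)

S. Kumar, *Geometry of orbits of permanents and determinants*, Comment. Math. Helv. 88 (2013)
759–788 = arXiv:1007.1695 [Kumar2013]: Thm. 3.8 (held text `paper:arxiv-1007.1695` p0005.txt:L126)
«For any `m ≥ 3`, `𝒳 = \overline{G·det}` is not normal» and Thm. 4.5 (p0007.txt:L72) «For `n ≥ 3`, the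
subvariety `\overline{GL(End 𝔳₁)·perm} ⊂ S^n((End 𝔳₁)^*)` is not normal»; quoted by Bürgisser 2024
§7.2 and Landsberg 2017 Thm. 10.3.2.1. Typed (val-lit t09, file of record `Bur24GCTOpenProblems.lean`,
row Bur2024-A) as the named facts `Kumar2013_thm_3_8` / `Kumar2013_thm_4_5`:
`∀ m ≥ 3, ¬ IsIntegrallyClosed (OrbitCoordRing (detPoly (Fin m) ℂ) m)` and the same for `perPoly`.

DISCHARGED here BY NAME. ROUTE (disclosed deviation from Kumar's printed proofs, which go through GIT:
the boundary `𝒳 ∖ G·det` has a component of codimension one carrying a `G`-module that does not occur in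
`ℂ[𝒳]`, Zariski's main theorem; §3–§4 of the paper): the two statements are VERBATIM the `det_n` /
`per_n` clauses of Bürgisser–Ikenmeyer 2017, Cor. 3.29 (2) («The orbit closures of `det_n` and `per_n`
are not normal if `n > 2`», J. Algebra 477, arXiv:1511.02927 main.tex L1538), which the tree PROVES
(`BI2017_cor_3_29_2_det`, `BI2017_cor_3_29_2_per`, `BI17NonNormalOrbitClosuresProofs.lean`, val-lit t09:
`det_n`, `per_n` are polystable with stabilizer period `≤ 2 < n`, then BI 2017 Cor. 3.17 (1) — a
non-normality criterion through the fundamental invariant, BI 2017 Thm. 3.10). Same `OrbitCoordRing`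
(`OrbitCoordinateRing.lean`: the coordinate ring of the `GL_{n²}`-orbit closure in `Sym^n`), same side
condition (`3 ≤ n ↔ 2 < n`). BI 2017 themselves cite [Kum13] for these statements (Cor. 3.29 is their
re-derivation), so nothing circular is involved.

`Kumar2013_thm_8_4` (the PADDED permanent `x₁₁^{m−n} per_n`, `m ≥ 2n`) is NOT covered by this route
(the padded permanent is not polystable: it lies in the null cone of `SL_{m²}`) and stays a named fact.

Theorem-only file: no definition, no new named fact; net debt −2. HONEST FRAMING: typed literature
bookkeeping; `VP ≠ VNP` is NOT proved and nothing here is progress on it.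

## References

* [Kumar2013] S. Kumar, *Geometry of orbits of permanents and determinants*, Comment. Math. Helv.
  88 (2013) 759–788, Thms. 3.8, 4.5 (arXiv:1007.1695 numbering). [cite: Kumar2013, Thm. 3.8] [cite: Kumar2013, Thm. 4.5]
* [BurgisserIkenmeyer2017] P. Bürgisser, C. Ikenmeyer, *Fundamental invariants of orbit closures*,
  J. Algebra 477 (2017) 390–434, Cor. 3.29 (2) with Cor. 3.17 (1). [cite: BurgisserIkenmeyer2017, Cor. 3.29]
* [LandsbergGCT2017] J. M. Landsberg, *Geometry and complexity theory*, CUP 2017, Thm. 10.3.2.1.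
* [Burgisser2024Completeness] P. Bürgisser, arXiv:2406.06217, §7.2.

## Tree

`Kumar2013_thm_3_8`, `Kumar2013_thm_4_5` (`Bur24GCTOpenProblems`); `BI2017_cor_3_29_2_det`,
`BI2017_cor_3_29_2_per` (`BI17NonNormalOrbitClosuresProofs`). Standard axioms only.
-/

namespace Literature.Computability.AlgebraicComplexity

/-- **Kumar 2013, Thm. 3.8 — DISCHARGED** («For any `m ≥ 3`, `\overline{G·det}` is not normal»;
`paper:arxiv-1007.1695` p0005.txt:L126): by name from the tree's proof of Bürgisser–Ikenmeyer 2017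
Cor. 3.29 (2), `det` clause (`BI2017_cor_3_29_2_det`; route: polystability + stabilizer period `≤ 2 < m`
+ BI 2017 Cor. 3.17 (1), not Kumar's GIT proof).
[cite: Kumar2013, Thm. 3.8] [cite: BurgisserIkenmeyer2017, Cor. 3.29] -/
theorem Kumar2013_thm_3_8_holds : Kumar2013_thm_3_8 :=
  fun _ hm => BI2017_cor_3_29_2_det (by omega)

/-- **Kumar 2013, Thm. 4.5 — DISCHARGED** («For `n ≥ 3`, `\overline{GL(End 𝔳₁)·perm}` is not normal»;
`paper:arxiv-1007.1695` p0007.txt:L72): by name from the tree's proof of Bürgisser–Ikenmeyer 2017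
Cor. 3.29 (2), `per` clause (`BI2017_cor_3_29_2_per`).
[cite: Kumar2013, Thm. 4.5] [cite: BurgisserIkenmeyer2017, Cor. 3.29] -/
theorem Kumar2013_thm_4_5_holds : Kumar2013_thm_4_5 :=
  fun _ hn => BI2017_cor_3_29_2_per (by omega)

/-- Landsberg 2017, Thm. 10.3.2.1, first two clauses, unconditional: for `n ≥ 3` neither `𝒟et_n` nor
`𝒫erm_n^n` is normal. [cite: LandsbergGCT2017, Thm. 10.3.2.1] -/
theorem not_isIntegrallyClosed_orbitCoordRing_det_and_per {n : ℕ} (hn : 3 ≤ n) :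
    ¬ IsIntegrallyClosed (OrbitCoordRing (detPoly (Fin n) ℂ) n) ∧
      ¬ IsIntegrallyClosed (OrbitCoordRing (perPoly (Fin n) ℂ) n) :=
  ⟨Kumar2013_thm_3_8_holds n hn, Kumar2013_thm_4_5_holds n hn⟩

end Literature.Computability.AlgebraicComplexity
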